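/-
Copyright (c) 2026 the pub-hodgecm-mathlib formalisation cell (harness21).  Prover seat hodgecm-mathlib-LH4-p02 (g12): STAGE 1a «(D-RAM) FOUR-FRAME» squad of
crux H413 (director s1808; heir LEAD F0P3a-plan (g18) T17-27 DIRECTIVE b9ecbbedecc9c5ae D3; dealer LH4-plan (g10) deal g10-#2 «(ii-0) htr₂-WILD»), FILE 1 of 2
«THE TYPE-TWO GRAM LEMMAS AND THE NORM–TRACE DESCENT AT A WILD RAMIFIED PLACE»; 2026-09-03.  §1–§2 are ADAPTED from ★ F0P3a-p07 (g11)
`UnitaryLatticeTreeTypeTwoGramOfTrace` §1–§2 (the integral trace-one element replaced by the adjugate bound of its §3), §3 from ★ `UnitaryLatticeTreeTypeTwoTransitiveRamified` §2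
(`|2| = 1` replaced by «`σ`-fixed elements have even valuation»); §4 (the norm–trace descent) is new.
-/
import Literature.NumberTheory.Automorphic.UnitaryLatticeTreeTypeTwoGramOfTrace           -- ★ htr₂-ram FILE 1 (F0P3a-p07 (g11)): `typeTwo_block_of_involution`; brings ★ T1d′ FILE 1 `UnitaryLatticeTreeTypeTwoGram`
import Literature.NumberTheory.Automorphic.UnitaryLatticeTreeResiduallyUnipotentCorner     -- ★ S-a3 helpers (F0P3a-p07 (g11)): `residue_eq_zero_iff_v_lt_one`, `residue_eq_of_v_sub_lt_one`
import Mathlib.FieldTheory.Finite.Basic                                                     -- `FiniteField.isSquare_of_char_two`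
import HarnessLib

/-!
# The lattice graph of a hermitian space — htr₂-wild FILE 1: THE TYPE-TWO GRAM MATRIX AND THE NORM–TRACE DESCENT AT A WILD RAMIFIED PLACE
# (Jacobowitz 1962 §4, §§9–11; O'Meara §63, §82F; Serre, *Local Fields* V §3)

Topic `NumberTheory/Automorphic`; namespace `Literature.NumberTheory.Automorphic.UnitaryLatticeTree`.  THEOREMS ONLY (no definition, no instance, no notation, no named fact,
no `sorry`); kernel lane.  Cell `pub/hodgecm-mathlib` (D-0151), crux H413 = `stmt-HodgeConjecture-24833`; road «(D-RAM) FOUR-FRAME» (STAGE 1a), unit (ii-0) «the `U(3)` lattice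
graph at a WILD ramified dyadic place is a tree», brick **htr₂-wild** = the discharge of the binder `htr₂` of ★ `isTree_latticeGraph_three_of_transitive`
(`UnitaryLatticeTreeFramesOfInvolution` §3) — type-two transitivity of `U(σ, J₀)` — WITHOUT `|2| = 1`, WITHOUT `σϖ = −ϖ`, WITHOUT the first-order norm property `hnorm` of the
tame files (false at a wild place).  This file carries the Gram-matrix lemmas and the one arithmetic input; FILE 2 (`UnitaryLatticeTreeTypeTwoTransitiveWild`) the transitivity.
THE RAMIFIED DATUM used (⊆ the conjuncts of the cell's `IsRamifiedQuadraticDatum σ ϖ d t`, plus a finite residue field): `σ` an involution preserving `v`; `ϖ` a uniformiser;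
`σ` trivial on the residue field (`hres`); RAMIFIED: a non-zero `σ`-fixed element has EVEN valuation (`heven`); `2 ≠ 0` where a trace must be halved (tame ∕ R-P ∕ R-U alike).
THE MATHEMATICS.  (§1) A type-two vertex `M = latt g` of `(K³, J₀)` (`G = ᵗσ(g)J₀g` integral, `ϖG⁻¹` integral, `|det G| = |ϖ|²`) has `adj G = (det G∕ϖ)·(ϖG⁻¹) ∈ ϖM₃(𝒪)`, so
every `2 × 2` minor of `G` lies in `ϖ𝒪`: a unit entry `G_{ij}`, `i ≠ j`, forces `|G_{ii}G_{jj}| = |G_{ij}G_{ji}| = 1`, hence a unit DIAGONAL entry — no trace-one element is needed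
(contrast ★ `exists_basis_v_B₀_eq_one_of_trace`); two transvections then give an orthogonal basis `x ⊥ c₁, c₂` (§2, verbatim the ★ argument).  (§3) In that basis the block
`G₁ = Gram(c₁, c₂)` has `|G₁| ≤ |ϖ|` entrywise and `|det G₁| = |ϖ|²` (★ `typeTwo_block_of_involution`); its diagonal entries `h(c_a,c_a)` are `σ`-FIXED, hence of even valuation,
hence `≤ |ϖ|²` — and then `|h(c₁,c₂)| = |h(c₂,c₁)| = |ϖ|`.  (§4) THE NORM–TRACE DESCENT (the one arithmetic input of the wild case, replacing `½` and `hnorm`): for a `σ`-fixed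
unit `e` and a `σ`-fixed `c` with `|c| ≤ |ϖ|²` there are `γ ∈ ϖ𝒪` and `ν ∈ 𝒪` with `c + e·N(γ) + (ν·σϖ + σν·ϖ) = 0`.  STEP: `|c| = |ϖ|^{2j}` (even!), `r = c∕N(ϖ^j)` a `σ`-fixed unit,
`ρ̄² = −r̄∕ē` in the FINITE residue field of characteristic `2` (every element a square; `|2| < 1` in the wild branch), `γ = ϖ^jρ`: `|c + eN(γ)| < |c|`; cross terms
`e(σγ·γ′ + σγ′·γ) = μσϖ + σμϖ` with `μ = eσγ′γ∕σϖ ∈ 𝒪`; after `n` steps `|c_n| ≤ |ϖ|^{2n}|c| ≤ |2ϖ|`, and `ν = −c_n∕(2σϖ) ∈ 𝒪` finishes (`νσϖ + σνϖ = −c_n`); at a TAME place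
(`|2| = 1`) the last move alone suffices.
HONEST LABEL: HC_CM is proved only modulo the 7 printed citations (2 remaining: hLiu418 = stmt-HodgeConjecture-24832, h413 = stmt-HodgeConjecture-24833) until rung 0 closes; nothing
printed is asserted here (elementary lattice algebra and `ϖ`-adic descent over a valuation ring with involution); (D-RAM) `stub_DyRamCore` stays PRINT until the road's END lands.

* §1 **`exists_basis_v_B₀_eq_one_of_adjugate`** (datum-free unit diagonal entry).  §2 **`exists_orthogonal_basis_of_adjugate`**.
* §3 `v_le_sq_of_map_eq_self`, **`typeTwo_block_of_ramified`**.  §4 `exists_norm_step_of_ramified`, `norm_trace_descent_of_ramified`, **`exists_norm_add_trace_eq_zero_of_ramified`**.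

## References
* [Jacobowitz1962] R. Jacobowitz, *Hermitian forms over local fields*, Amer. J. Math. 84 (1962), §4 (Jordan splittings), §§9–11 (ramified dyadic: `H(i)`, Prop. 9.1, Thm. 11.4).
* [Omeara1963] O. T. O'Meara, *Introduction to Quadratic Forms* (1963), §63A (local squares, dyadic), §82F, §91C.  [Serre1979] J.-P. Serre, *Local Fields*, GTM 67 (1979), Ch. V §3.
* [BruhatTits1972] F. Bruhat, J. Tits, *Groupes réductifs sur un corps local I*, Publ. Math. IHÉS 41 (1972), §10.
-/

set_option autoImplicit false

noncomputable section

open scoped Valued WithZero Matrix MatrixGroups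

namespace Literature.NumberTheory.Automorphic.UnitaryLatticeTree

open Literature.NumberTheory.Automorphic Literature.NumberTheory.Automorphic.HermitianLattice Literature.NumberTheory.Automorphic.CartanUnique

variable {K : Type*} [Field K] [Valued K ℤᵐ⁰] {σ : K →+* K} {ϖ : K}

/-! ## §1 A basis vector of unit length, datum-free -/
/-- **A basis of a type-two vertex whose first vector has unit length — NO trace element** (`σ` an involution preserving `v`; any `σϖ`, any residue characteristic).
For a type-two vertex lattice `M = latt g` of `(K³, J₀)` the Gram matrix `G` has `adj G = (det G ∕ ϖ)·(ϖG⁻¹) ∈ ϖ·M₃(𝒪)`; a unit entry exists (★ `exists_v_apply_eq_one_of_v_det`),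
and if it is `G_{ij}` with `i ≠ j` then the diagonal adjugate entry `G_{ii}G_{jj} − G_{ij}G_{ji}` of the complementary index would be a unit unless `G_{ii}`, `G_{jj}` are units
too — so a unit DIAGONAL entry exists; a swap moves it to index `0`. [cite: Jacobowitz1962, §4] [cite: Omeara1963, §82F] -/
theorem exists_basis_v_B₀_eq_one_of_adjugate (hσ : ∀ x, σ (σ x) = x) (hvσ : ∀ a, Valued.v (σ a) = Valued.v a) (hϖ : Valued.v ϖ = WithZero.exp (-1 : ℤ))
    {M : Submodule 𝒪[K] (Fin 3 → K)} (hM : IsVertexLattice σ ϖ ((StdForm.antidiagonal 3).over K) 2 M) :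
    ∃ g : GL (Fin 3) K, M = latt (g : Matrix (Fin 3) (Fin 3) K) ∧
      Valued.v (B₀ σ 3 ((g : Matrix (Fin 3) (Fin 3) K).mulVec (Pi.single 0 1)) ((g : Matrix (Fin 3) (Fin 3) K).mulVec (Pi.single 0 1))) = 1 := by
  obtain ⟨g, rfl, hint, hinv, hdet⟩ := id hM
  have hϖ0 : ϖ ≠ 0 := uniformizer_ne_zero hϖ
  have hϖ1 : Valued.v ϖ < 1 := by rw [hϖ, ← WithZero.exp_zero, WithZero.exp_lt_exp]; omega
  -- a swap moving index `k` to `0`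
  have hswap : ∀ k : Fin 3, ∃ P : GL (Fin 3) K, IsIntMatrix (P : Matrix (Fin 3) (Fin 3) K) ∧ IsIntMatrix ((P⁻¹ : GL (Fin 3) K) : Matrix (Fin 3) (Fin 3) K) ∧
      (P : Matrix (Fin 3) (Fin 3) K).mulVec (Pi.single 0 1) = Pi.single k 1 := by
    intro k
    have hPP : (Equiv.swap (0 : Fin 3) k).permMatrix K * (Equiv.swap (0 : Fin 3) k).permMatrix K = 1 := by
      rw [← Matrix.permMatrix_mul, Equiv.swap_mul_self, Matrix.permMatrix_one]
    refine ⟨⟨_, _, hPP, hPP⟩, isIntMatrix_permMatrix _, isIntMatrix_permMatrix _, ?_⟩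
    change ((Equiv.swap (0 : Fin 3) k).permMatrix K).mulVec (Pi.single 0 1) = Pi.single k 1
    rw [permMatrix_swap_mulVec_single, Equiv.swap_apply_left]
  set G := formCongr σ g ((StdForm.antidiagonal 3).over K) with hGdef
  have hG : ∀ a b, G a b = B₀ σ 3 ((g : Matrix (Fin 3) (Fin 3) K).mulVec (Pi.single a 1)) ((g : Matrix (Fin 3) (Fin 3) K).mulVec (Pi.single b 1)) :=
    formCongr_apply_eq_B₀ g
  have hherm : ∀ a b, G b a = σ (G a b) := fun a b => by rw [hG, hG]; exact (isHermitianForm_B₀ hσ _ _).symm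
  -- `adj G ∈ ϖ M₃(𝒪)`
  have hGu : IsUnit G.det := by
    rw [isUnit_iff_ne_zero]; intro h; rw [h, map_zero] at hdet; exact pow_ne_zero 2 ((Valuation.ne_zero_iff _).2 hϖ0) hdet.symm
  have hadj : ∀ a b, Valued.v (G.adjugate a b) ≤ Valued.v ϖ := by
    intro a b
    have hadjeq : G.adjugate = (G.det * ϖ⁻¹) • (ϖ • G⁻¹) := by
      rw [smul_smul, mul_assoc, inv_mul_cancel₀ hϖ0, mul_one, Matrix.inv_def, smul_smul, Ring.inverse_eq_inv', mul_inv_cancel₀ hGu.ne_zero, one_smul]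
    have hvϖ0 : Valued.v ϖ ≠ 0 := (Valuation.ne_zero_iff Valued.v).2 hϖ0
    rw [hadjeq, Matrix.smul_apply, smul_eq_mul, map_mul, map_mul, map_inv₀, hdet, pow_two, mul_assoc, mul_assoc, mul_inv_cancel_left₀ hvϖ0]
    exact mul_le_of_le_one_right' (hinv a b)
  -- every complementary `2 × 2` minor is small
  have hminor : ∀ a b : Fin 3, a ≠ b → Valued.v (G a a * G b b - G a b * G b a) ≤ Valued.v ϖ := by
    have e00 : G.adjugate 0 0 = G 1 1 * G 2 2 - G 1 2 * G 2 1 := by rw [Matrix.adjugate_fin_three]; rfl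
    have e11 : G.adjugate 1 1 = G 0 0 * G 2 2 - G 0 2 * G 2 0 := by rw [Matrix.adjugate_fin_three]; rfl
    have e22 : G.adjugate 2 2 = G 0 0 * G 1 1 - G 0 1 * G 1 0 := by rw [Matrix.adjugate_fin_three]; rfl
    intro a b hab
    fin_cases a <;> fin_cases b <;> simp only [Fin.zero_eta, Fin.mk_one, Fin.reduceFinMk] at hab ⊢
    · exact absurd rfl hab
    · have h := hadj 2 2; rw [e22] at h; exact h
    · have h := hadj 1 1; rw [e11] at h; exact h
    · have h := hadj 2 2; rw [e22] at h
      rw [show G 1 1 * G 0 0 - G 1 0 * G 0 1 = G 0 0 * G 1 1 - G 0 1 * G 1 0 by ring]; exact h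
    · exact absurd rfl hab
    · have h := hadj 0 0; rw [e00] at h; exact h
    · have h := hadj 1 1; rw [e11] at h
      rw [show G 2 2 * G 0 0 - G 2 0 * G 0 2 = G 0 0 * G 2 2 - G 0 2 * G 2 0 by ring]; exact h
    · have h := hadj 0 0; rw [e00] at h
      rw [show G 2 2 * G 1 1 - G 2 1 * G 1 2 = G 1 1 * G 2 2 - G 1 2 * G 2 1 by ring]; exact h
    · exact absurd rfl hab
  -- hence a unit DIAGONAL entry
  have hdiag : ∃ k, Valued.v (G k k) = 1 := by
    by_contra hno
    push Not at hno
    obtain ⟨i, j, hij⟩ := exists_v_apply_eq_one_of_v_det hϖ hint hdet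
    have hne : i ≠ j := fun h => hno i (by rw [h] at hij ⊢; exact hij)
    have hji : Valued.v (G j i) = 1 := by rw [hherm, hvσ]; exact hij
    have hii : Valued.v (G i i) < 1 := lt_of_le_of_ne (hint i i) (hno i)
    have hjj : Valued.v (G j j) < 1 := lt_of_le_of_ne (hint j j) (hno j)
    have hlt : Valued.v (G i i * G j j) < Valued.v (G i j * G j i) := by
      rw [map_mul, map_mul, hij, hji, mul_one]
      calc Valued.v (G i i) * Valued.v (G j j) ≤ Valued.v (G i i) * 1 := mul_le_mul' le_rfl hjj.le
        _ < 1 := by rw [mul_one]; exact hii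
    have hone : Valued.v (G i i * G j j - G i j * G j i) = 1 := by
      rw [Valuation.map_sub_eq_of_lt_right _ hlt, map_mul, hij, hji, mul_one]
    have h := hminor i j hne
    rw [hone] at h
    exact not_lt.2 h hϖ1
  obtain ⟨k, hk⟩ := hdiag
  obtain ⟨P, hP, hP', hPk⟩ := hswap k
  refine ⟨g * P, (latt_mul_eq_of_isIntMatrix g P hP hP').symm, ?_⟩
  rw [Units.val_mul, ← Matrix.mulVec_mulVec, hPk, ← hG]; exact hk

/-! ## §2 An orthogonal basis adapted to the unit vector, datum-free -/
/-- **JORDAN SPLITTING, matrix form, datum-free**: a type-two vertex lattice `M` of `(K³, J₀)` (`σ` an involution preserving `v`; any `σϖ`, any residue characteristic) has a basis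
`g` with `|h(g e₀, g e₀)| = 1` and `h(g e₀, g e₁) = h(g e₀, g e₂) = 0` — `M = 𝒪x ⊥ N′`: the two transvections `e_j ↦ e_j − (h(x, g e_j) ∕ h(x,x))·e₀` applied to the basis of
`exists_basis_v_B₀_eq_one_of_adjugate` (verbatim the argument of ★ `exists_orthogonal_basis_of_trace`). [cite: Jacobowitz1962, §4] [cite: Omeara1963, §91C] -/
theorem exists_orthogonal_basis_of_adjugate (hσ : ∀ x, σ (σ x) = x) (hvσ : ∀ a, Valued.v (σ a) = Valued.v a) (hϖ : Valued.v ϖ = WithZero.exp (-1 : ℤ))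
    {M : Submodule 𝒪[K] (Fin 3 → K)} (hM : IsVertexLattice σ ϖ ((StdForm.antidiagonal 3).over K) 2 M) :
    ∃ g : GL (Fin 3) K, M = latt (g : Matrix (Fin 3) (Fin 3) K) ∧
      Valued.v (B₀ σ 3 ((g : Matrix (Fin 3) (Fin 3) K).mulVec (Pi.single 0 1)) ((g : Matrix (Fin 3) (Fin 3) K).mulVec (Pi.single 0 1))) = 1 ∧
      B₀ σ 3 ((g : Matrix (Fin 3) (Fin 3) K).mulVec (Pi.single 0 1)) ((g : Matrix (Fin 3) (Fin 3) K).mulVec (Pi.single 1 1)) = 0 ∧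
      B₀ σ 3 ((g : Matrix (Fin 3) (Fin 3) K).mulVec (Pi.single 0 1)) ((g : Matrix (Fin 3) (Fin 3) K).mulVec (Pi.single 2 1)) = 0 := by
  obtain ⟨g, rfl, hx⟩ := exists_basis_v_B₀_eq_one_of_adjugate hσ hvσ hϖ hM
  obtain ⟨hint, -, -⟩ := vertexTriple_of_latt_eq hvσ hM
  have hG : ∀ a b, formCongr σ g ((StdForm.antidiagonal 3).over K) a b =
      B₀ σ 3 ((g : Matrix (Fin 3) (Fin 3) K).mulVec (Pi.single a 1)) ((g : Matrix (Fin 3) (Fin 3) K).mulVec (Pi.single b 1)) := formCongr_apply_eq_B₀ g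
  set x : Fin 3 → K := (g : Matrix (Fin 3) (Fin 3) K).mulVec (Pi.single 0 1) with hxdef
  set ε : K := B₀ σ 3 x x with hε
  have hε0 : ε ≠ 0 := fun h => by rw [h, map_zero] at hx; exact zero_ne_one hx
  -- the two transvection coefficients
  have hcoef : ∀ k : Fin 3, Valued.v (-(B₀ σ 3 x ((g : Matrix (Fin 3) (Fin 3) K).mulVec (Pi.single k 1))) / ε) ≤ 1 := fun k => by
    rw [map_div₀, Valuation.map_neg, hx, div_one, hxdef, ← hG]; exact hint 0 k
  have hT : ∀ k : Fin 3, k ≠ 0 → ∀ a : K, Valued.v a ≤ 1 → ∃ T : GL (Fin 3) K, IsIntMatrix (T : Matrix (Fin 3) (Fin 3) K) ∧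
      IsIntMatrix ((T⁻¹ : GL (Fin 3) K) : Matrix (Fin 3) (Fin 3) K) ∧ (T : Matrix (Fin 3) (Fin 3) K) = Matrix.transvection 0 k a := by
    intro k hk a ha
    have hdetT : (Matrix.transvection 0 k a : Matrix (Fin 3) (Fin 3) K).det ≠ 0 := by rw [Matrix.det_transvection_of_ne 0 k hk.symm a]; exact one_ne_zero
    refine ⟨Matrix.GeneralLinearGroup.mkOfDetNeZero _ hdetT, isIntMatrix_transvection ha, ?_, rfl⟩
    rw [Matrix.coe_units_inv, show ((Matrix.GeneralLinearGroup.mkOfDetNeZero _ hdetT : GL (Fin 3) K) : Matrix (Fin 3) (Fin 3) K) = Matrix.transvection 0 k a from rfl,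
      Matrix.inv_eq_left_inv (by rw [Matrix.transvection_mul_transvection_same 0 k hk.symm, neg_add_cancel, Matrix.transvection_zero])]
    exact isIntMatrix_transvection (by rw [Valuation.map_neg]; exact ha)
  obtain ⟨T₁, hT₁, hT₁', hT₁v⟩ := hT 1 (by decide) _ (hcoef 1)
  obtain ⟨T₂, hT₂, hT₂', hT₂v⟩ := hT 2 (by decide) _ (hcoef 2)
  refine ⟨g * T₁ * T₂, by rw [latt_mul_eq_of_isIntMatrix _ T₂ hT₂ hT₂', latt_mul_eq_of_isIntMatrix g T₁ hT₁ hT₁'], ?_, ?_, ?_⟩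
  all_goals simp only [Units.val_mul, ← Matrix.mulVec_mulVec, hT₁v, hT₂v, transvection_mulVec_single, Fin.reduceEq, if_false, if_true, zero_smul, add_zero,
    Matrix.mulVec_add, Matrix.mulVec_smul, map_add, form_smul_right]
  · exact hx
  · rw [← hxdef, ← hε, div_mul_cancel₀ _ hε0, add_neg_cancel]
  · rw [← hxdef, ← hε, div_mul_cancel₀ _ hε0, add_neg_cancel]

/-! ## §3 The type-two block at a ramified place: diagonal entries of even valuation -/
/-- At a RAMIFIED place (a non-zero `σ`-fixed element has even valuation) a `σ`-fixed element of valuation `≤ |ϖ|` has valuation `≤ |ϖ|²`. [cite: Serre1979, Ch. V §3] -/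
theorem v_le_sq_of_map_eq_self (hϖ : Valued.v ϖ = WithZero.exp (-1 : ℤ)) (heven : ∀ x : K, σ x = x → x ≠ 0 → ∃ n : ℤ, Valued.v x = WithZero.exp (2 * n))
    {a : K} (hσa : σ a = a) (ha : Valued.v a ≤ Valued.v ϖ) : Valued.v a ≤ Valued.v ϖ ^ 2 := by
  by_cases ha0 : a = 0
  · rw [ha0, map_zero]; exact zero_le
  · obtain ⟨n, hn⟩ := heven a hσa ha0
    rw [hn, hϖ, WithZero.exp_le_exp] at ha; rw [hn, hϖ, pow_two, ← WithZero.exp_add, WithZero.exp_le_exp]; omega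

/-- **THE TYPE-TWO BLOCK AT A RAMIFIED PLACE.**  In an orthogonal basis `g` (`|h(g₀,g₀)| = 1`, `h(g₀,g₁) = h(g₀,g₂) = 0`) of a type-two vertex of `(K³, J₀)` at a ramified place
(`heven`), the `ϖ`-modular block satisfies `|h(g₁,g₁)| ≤ |ϖ|²`, `|h(g₂,g₂)| ≤ |ϖ|²` (its diagonal entries are `σ`-FIXED, so of even valuation — this replaces «`σr = −r ⇒ r ∈ 𝔪`»
of the tame file, no `|2| = 1`, no `σϖ = −ϖ`) and therefore `|h(g₁,g₂)| = |h(g₂,g₁)| = |ϖ|` (unit determinant of `ϖ⁻¹G₁`, ★ `typeTwo_block_of_involution`): the residual form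
`ϖ⁻¹h` on the block is ALTERNATING. [cite: Jacobowitz1962, §9] [cite: Omeara1963, §82F] -/
theorem typeTwo_block_of_ramified (hσ : ∀ x, σ (σ x) = x) (hvσ : ∀ a, Valued.v (σ a) = Valued.v a) (hϖ : Valued.v ϖ = WithZero.exp (-1 : ℤ))
    (heven : ∀ x : K, σ x = x → x ≠ 0 → ∃ n : ℤ, Valued.v x = WithZero.exp (2 * n))
    {g : GL (Fin 3) K} (hM : IsVertexLattice σ ϖ ((StdForm.antidiagonal 3).over K) 2 (latt (g : Matrix (Fin 3) (Fin 3) K)))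
    (hx : Valued.v (B₀ σ 3 ((g : Matrix (Fin 3) (Fin 3) K).mulVec (Pi.single 0 1)) ((g : Matrix (Fin 3) (Fin 3) K).mulVec (Pi.single 0 1))) = 1)
    (h01 : B₀ σ 3 ((g : Matrix (Fin 3) (Fin 3) K).mulVec (Pi.single 0 1)) ((g : Matrix (Fin 3) (Fin 3) K).mulVec (Pi.single 1 1)) = 0)
    (h02 : B₀ σ 3 ((g : Matrix (Fin 3) (Fin 3) K).mulVec (Pi.single 0 1)) ((g : Matrix (Fin 3) (Fin 3) K).mulVec (Pi.single 2 1)) = 0) :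
    Valued.v (B₀ σ 3 ((g : Matrix (Fin 3) (Fin 3) K).mulVec (Pi.single 1 1)) ((g : Matrix (Fin 3) (Fin 3) K).mulVec (Pi.single 1 1))) ≤ Valued.v ϖ ^ 2 ∧
    Valued.v (B₀ σ 3 ((g : Matrix (Fin 3) (Fin 3) K).mulVec (Pi.single 2 1)) ((g : Matrix (Fin 3) (Fin 3) K).mulVec (Pi.single 2 1))) ≤ Valued.v ϖ ^ 2 ∧
    Valued.v (B₀ σ 3 ((g : Matrix (Fin 3) (Fin 3) K).mulVec (Pi.single 1 1)) ((g : Matrix (Fin 3) (Fin 3) K).mulVec (Pi.single 2 1))) = Valued.v ϖ ∧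
    Valued.v (B₀ σ 3 ((g : Matrix (Fin 3) (Fin 3) K).mulVec (Pi.single 2 1)) ((g : Matrix (Fin 3) (Fin 3) K).mulVec (Pi.single 1 1))) = Valued.v ϖ := by
  have hϖ0 : ϖ ≠ 0 := uniformizer_ne_zero hϖ
  have hvϖ0 : Valued.v ϖ ≠ 0 := (Valuation.ne_zero_iff Valued.v).2 hϖ0
  have hϖ1 : Valued.v ϖ < 1 := by rw [hϖ, ← WithZero.exp_zero, WithZero.exp_lt_exp]; omega
  obtain ⟨hblk, hdet⟩ := typeTwo_block_of_involution hσ hvσ hϖ0 hM hx h01 h02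
  set c₁ : Fin 3 → K := (g : Matrix (Fin 3) (Fin 3) K).mulVec (Pi.single 1 1) with hc₁
  set c₂ : Fin 3 → K := (g : Matrix (Fin 3) (Fin 3) K).mulVec (Pi.single 2 1) with hc₂
  have h11 : Valued.v (B₀ σ 3 c₁ c₁) ≤ Valued.v ϖ ^ 2 :=
    v_le_sq_of_map_eq_self hϖ heven ((isHermitianForm_B₀ hσ).apply_self c₁) (hblk 1 1 (by decide) (by decide))
  have h22 : Valued.v (B₀ σ 3 c₂ c₂) ≤ Valued.v ϖ ^ 2 :=
    v_le_sq_of_map_eq_self hϖ heven ((isHermitianForm_B₀ hσ).apply_self c₂) (hblk 2 2 (by decide) (by decide))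
  have h21eq : Valued.v (B₀ σ 3 c₂ c₁) = Valued.v (B₀ σ 3 c₁ c₂) := by rw [← (isHermitianForm_B₀ hσ) c₁ c₂, hvσ]
  have h12 : Valued.v (B₀ σ 3 c₁ c₂) = Valued.v ϖ := by
    have hle : Valued.v (B₀ σ 3 c₁ c₂) ≤ Valued.v ϖ := hblk 1 2 (by decide) (by decide)
    by_contra hne
    have hlt : Valued.v (B₀ σ 3 c₁ c₂) < Valued.v ϖ := lt_of_le_of_ne hle hne
    have hsmall : Valued.v (B₀ σ 3 c₁ c₁ * B₀ σ 3 c₂ c₂ - B₀ σ 3 c₁ c₂ * B₀ σ 3 c₂ c₁) < Valued.v ϖ ^ 2 := by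
      have hϖ2 : Valued.v ϖ ^ 2 < 1 := pow_lt_one' hϖ1 two_ne_zero
      refine Valuation.map_sub_lt _ ?_ ?_
      · rw [map_mul]
        calc Valued.v (B₀ σ 3 c₁ c₁) * Valued.v (B₀ σ 3 c₂ c₂) ≤ Valued.v ϖ ^ 2 * Valued.v ϖ ^ 2 := mul_le_mul' h11 h22
          _ < Valued.v ϖ ^ 2 := mul_lt_of_lt_one_right (pow_pos (zero_lt_iff.2 hvϖ0) 2) hϖ2
      · rw [map_mul, h21eq, pow_two]
        calc Valued.v (B₀ σ 3 c₁ c₂) * Valued.v (B₀ σ 3 c₁ c₂) ≤ Valued.v (B₀ σ 3 c₁ c₂) * Valued.v ϖ := mul_le_mul' le_rfl hle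
          _ < Valued.v ϖ * Valued.v ϖ := mul_lt_mul_of_pos_right hlt (zero_lt_iff.2 hvϖ0)
    rw [hdet] at hsmall; exact lt_irrefl _ hsmall
  exact ⟨h11, h22, h12, by rw [h21eq, h12]⟩

/-! ## §4 The norm–trace descent (the arithmetic input of the wild case) -/
/-- **ONE NORM DIGIT.**  At a wild ramified place (`|2| < 1`, so the FINITE residue field has characteristic `2` and every residue is a square; `σ` trivial on the residue field;
non-zero `σ`-fixed elements have even valuation): for a unit `e` and a non-zero `σ`-fixed `c` with `|c| < 1` there is `γ` with `|γ| ≤ |ϖ|` and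
`|c + e·σγ·γ| < |c|` — `|c| = |ϖ|^{2j}`, `r = c ∕ (σϖ^j·ϖ^j)` a `σ`-fixed unit, `ρ̄² = −r̄ ∕ ē`, `γ = ϖ^j ρ`. [cite: Omeara1963, §63A] [cite: Serre1979, Ch. V §3] -/
theorem exists_norm_step_of_ramified [Finite 𝓀[K]] (hσ : ∀ x, σ (σ x) = x) (hvσ : ∀ a, Valued.v (σ a) = Valued.v a) (hϖ : Valued.v ϖ = WithZero.exp (-1 : ℤ))
    (hres : ∀ x : K, Valued.v x ≤ 1 → Valued.v (σ x - x) < 1) (heven : ∀ x : K, σ x = x → x ≠ 0 → ∃ n : ℤ, Valued.v x = WithZero.exp (2 * n))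
    (h2 : Valued.v (2 : K) < 1) {e c : K} (hve : Valued.v e = 1) (hσc : σ c = c) (hc0 : c ≠ 0) (hvc : Valued.v c < 1) :
    ∃ γ : K, Valued.v γ ≤ Valued.v ϖ ∧ Valued.v (c + e * (σ γ * γ)) < Valued.v c := by
  have hϖ0 : ϖ ≠ 0 := uniformizer_ne_zero hϖ
  have hϖ1 : Valued.v ϖ < 1 := by rw [hϖ, ← WithZero.exp_zero, WithZero.exp_lt_exp]; omega
  -- `|c| = |ϖ|^{2j}`, `j ≥ 1`
  obtain ⟨n, hn⟩ := heven c hσc hc0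
  have hn1 : n ≤ -1 := by
    rw [hn, ← WithZero.exp_zero, WithZero.exp_lt_exp] at hvc; omega
  obtain ⟨j, hj⟩ : ∃ j : ℕ, (j : ℤ) = -n := ⟨(-n).toNat, by omega⟩
  have hj1 : 1 ≤ j := by omega
  have hvϖj : Valued.v (ϖ ^ j) = WithZero.exp n := by
    rw [map_pow, hϖ, ← WithZero.exp_nsmul]; congr 1; rw [nsmul_eq_mul]; omega
  set π : K := σ (ϖ ^ j) * ϖ ^ j with hπ
  have hσπ : σ π = π := by rw [hπ, map_mul, hσ, mul_comm]
  have hvπ : Valued.v π = Valued.v c := by rw [hπ, map_mul, hvσ, hvϖj, ← WithZero.exp_add, hn]; congr 1; ring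
  have hπ0 : π ≠ 0 := fun h => by rw [h, map_zero] at hvπ; exact hc0 ((Valuation.zero_iff _).1 hvπ.symm)
  -- the `σ`-fixed unit `r = c / π`
  set r : K := c / π with hr
  have hσr : σ r = r := by rw [hr, map_div₀, hσc, hσπ]
  have hvr : Valued.v r = 1 := by rw [hr, map_div₀, hvπ, div_self ((Valuation.ne_zero_iff _).2 hc0)]
  -- residue field of characteristic `2`: `−r̄/ē` is a square
  have hchar : ringChar 𝓀[K] = 2 := by
    apply CharP.ringChar_of_prime_eq_zero Nat.prime_two
    have h : ((2 : ℕ) : 𝓀[K]) = IsLocalRing.residue 𝒪[K] ⟨2, (mem_integer_iff' _).2 h2.le⟩ := by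
      rw [Nat.cast_ofNat, show (⟨2, _⟩ : 𝒪[K]) = 2 from Subtype.ext rfl, map_ofNat]
    rw [h, residue_eq_zero_iff_v_lt_one]; exact h2
  set rO : 𝒪[K] := ⟨r, (mem_integer_iff' _).2 hvr.le⟩ with hrO
  set eO : 𝒪[K] := ⟨e, (mem_integer_iff' _).2 hve.le⟩ with heO
  have hebar : IsLocalRing.residue 𝒪[K] eO ≠ 0 := fun h => by
    rw [residue_eq_zero_iff_v_lt_one] at h; exact lt_irrefl _ (hve ▸ h : Valued.v e < Valued.v e)
  obtain ⟨ρbar, hρbar⟩ := FiniteField.isSquare_of_char_two hchar (-(IsLocalRing.residue 𝒪[K] rO) / IsLocalRing.residue 𝒪[K] eO)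
  obtain ⟨ρO, hρO⟩ := IsLocalRing.residue_surjective ρbar
  set ρ : K := (ρO : K) with hρ
  have hvρ : Valued.v ρ ≤ 1 := (mem_integer_iff' _).1 ρO.2
  have hvσρ : Valued.v (σ ρ) ≤ 1 := by rw [hvσ]; exact hvρ
  set σρO : 𝒪[K] := ⟨σ ρ, (mem_integer_iff' _).2 hvσρ⟩ with hσρO
  have hσρbar : IsLocalRing.residue 𝒪[K] σρO = IsLocalRing.residue 𝒪[K] ρO := residue_eq_of_v_sub_lt_one (hres ρ hvρ)
  -- `r + e σρ ρ ∈ 𝔪`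
  have hkey : Valued.v (r + e * (σ ρ * ρ)) < 1 := by
    have hmem : Valued.v (r + e * (σ ρ * ρ)) ≤ 1 := by
      refine (Valuation.map_add _ _ _).trans (max_le hvr.le ?_)
      rw [map_mul, map_mul, hve, one_mul]; exact mul_le_one' hvσρ hvρ
    have hO : (⟨r + e * (σ ρ * ρ), (mem_integer_iff' _).2 hmem⟩ : 𝒪[K]) = rO + eO * (σρO * ρO) := Subtype.ext rfl
    rw [show r + e * (σ ρ * ρ) = ((⟨r + e * (σ ρ * ρ), (mem_integer_iff' _).2 hmem⟩ : 𝒪[K]) : K) from rfl, ← residue_eq_zero_iff_v_lt_one, hO,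
      map_add, map_mul, map_mul, hσρbar, hρO, ← hρbar, mul_div_cancel₀ _ hebar, add_neg_cancel]
  refine ⟨ϖ ^ j * ρ, ?_, ?_⟩
  · rw [map_mul]
    calc Valued.v (ϖ ^ j) * Valued.v ρ ≤ Valued.v (ϖ ^ j) * 1 := mul_le_mul' le_rfl hvρ
      _ = Valued.v ϖ ^ j := by rw [mul_one, map_pow]
      _ ≤ Valued.v ϖ ^ 1 := pow_le_pow_right_of_le_one' hϖ1.le hj1
      _ = Valued.v ϖ := pow_one _
  · have hc : c = π * r := by rw [hr, mul_div_cancel₀ _ hπ0]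
    have h : c + e * (σ (ϖ ^ j * ρ) * (ϖ ^ j * ρ)) = π * (r + e * (σ ρ * ρ)) := by
      rw [map_mul, hc, hπ]; ring
    rw [h, map_mul, hvπ]
    exact mul_lt_of_lt_one_right (zero_lt_iff.2 ((Valuation.ne_zero_iff _).2 hc0)) hkey

/-- **THE DESCENT.**  Same hypotheses; `e` a `σ`-fixed unit, `c` `σ`-fixed with `|c| ≤ |ϖ|²`.  For every `n` there are `γ ∈ ϖ𝒪` and `ν ∈ 𝒪` with
`|c + e·σγ·γ + (ν·σϖ + σν·ϖ)| ≤ |ϖ|^{2n}·|c|`: iterate `exists_norm_step_of_ramified` (each step gains `|ϖ|²` by evenness), absorbing the cross terms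
`e(σγ·γ′ + σγ′·γ) = μσϖ + σμϖ`, `μ = e·σγ′·γ ∕ σϖ ∈ 𝒪`. [cite: Omeara1963, §63A] [cite: Serre1979, Ch. V §3] -/
theorem norm_trace_descent_of_ramified [Finite 𝓀[K]] (hσ : ∀ x, σ (σ x) = x) (hvσ : ∀ a, Valued.v (σ a) = Valued.v a) (hϖ : Valued.v ϖ = WithZero.exp (-1 : ℤ))
    (hres : ∀ x : K, Valued.v x ≤ 1 → Valued.v (σ x - x) < 1) (heven : ∀ x : K, σ x = x → x ≠ 0 → ∃ n : ℤ, Valued.v x = WithZero.exp (2 * n))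
    (h2 : Valued.v (2 : K) < 1) {e c : K} (hσe : σ e = e) (hve : Valued.v e = 1) (hσc : σ c = c) (hvc : Valued.v c ≤ Valued.v ϖ ^ 2) (n : ℕ) :
    ∃ γ ν : K, Valued.v γ ≤ Valued.v ϖ ∧ Valued.v ν ≤ 1 ∧
      Valued.v (c + e * (σ γ * γ) + (ν * σ ϖ + σ ν * ϖ)) ≤ Valued.v ϖ ^ (2 * n) * Valued.v c := by
  have hϖ0 : ϖ ≠ 0 := uniformizer_ne_zero hϖ
  have hvϖ0 : Valued.v ϖ ≠ 0 := (Valuation.ne_zero_iff Valued.v).2 hϖ0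
  have hσϖ0 : σ ϖ ≠ 0 := (map_ne_zero σ).2 hϖ0
  have hϖ1 : Valued.v ϖ < 1 := by rw [hϖ, ← WithZero.exp_zero, WithZero.exp_lt_exp]; omega
  have hfix : ∀ γ ν : K, σ (c + e * (σ γ * γ) + (ν * σ ϖ + σ ν * ϖ)) = c + e * (σ γ * γ) + (ν * σ ϖ + σ ν * ϖ) := fun γ ν => by
    simp only [map_add, map_mul, hσ, hσe, hσc]; ring
  induction n with
  | zero =>
    refine ⟨0, 0, by rw [map_zero]; exact zero_le, by rw [map_zero]; exact zero_le, le_of_eq ?_⟩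
    rw [map_zero, mul_zero, mul_zero, add_zero, zero_mul, zero_mul, add_zero, add_zero, Nat.mul_zero, pow_zero, one_mul]
  | succ n ih =>
    obtain ⟨γ, ν, hγ, hν, hcn⟩ := ih
    set cn : K := c + e * (σ γ * γ) + (ν * σ ϖ + σ ν * ϖ) with hcn_def
    by_cases hcn0 : cn = 0
    · refine ⟨γ, ν, hγ, hν, ?_⟩
      rw [← hcn_def, hcn0, map_zero]; exact zero_le
    · have hvcn : Valued.v cn < 1 := by
        refine lt_of_le_of_lt hcn (lt_of_le_of_lt ?_ (lt_of_le_of_lt hvc (pow_lt_one' hϖ1 two_ne_zero)))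
        exact mul_le_of_le_one_left' (pow_le_one' hϖ1.le _)
      obtain ⟨γ', hγ', hlt⟩ := exists_norm_step_of_ramified hσ hvσ hϖ hres heven h2 hve (hfix γ ν) hcn0 hvcn
      -- the new datum
      set μ : K := e * (σ γ' * γ) / σ ϖ with hμ
      have hvμ : Valued.v μ ≤ 1 := by
        rw [hμ, map_div₀, map_mul, map_mul, hve, one_mul, hvσ, hvσ]
        refine div_le_one_of_le₀ ?_ zero_le
        calc Valued.v γ' * Valued.v γ ≤ Valued.v ϖ * Valued.v ϖ := mul_le_mul' hγ' hγ
          _ ≤ Valued.v ϖ * 1 := mul_le_mul' le_rfl hϖ1.le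
          _ = Valued.v ϖ := mul_one _
      refine ⟨γ + γ', ν - μ, (Valuation.map_add _ _ _).trans (max_le hγ hγ'), (Valuation.map_sub _ _ _).trans (max_le hν hvμ), ?_⟩
      have hσμ : σ μ = e * (γ' * σ γ) / ϖ := by rw [hμ, map_div₀, map_mul, map_mul, hσ, hσ, hσe]
      have heq : c + e * (σ (γ + γ') * (γ + γ')) + ((ν - μ) * σ ϖ + σ (ν - μ) * ϖ) = cn + e * (σ γ' * γ') := by
        rw [map_sub, hσμ, hcn_def, map_add, hμ]
        field_simp
        ring
      rw [heq]
      -- `|cn + e σγ′ γ′| < |cn| ≤ |ϖ|^{2n}|c|`, and the left side is `σ`-fixed: gain `|ϖ|²`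
      have hσnew : σ (cn + e * (σ γ' * γ')) = cn + e * (σ γ' * γ') := by
        rw [map_add, map_mul, map_mul, hσ, hσe, hcn_def, hfix γ ν]; ring
      by_cases hnew0 : cn + e * (σ γ' * γ') = 0
      · rw [hnew0, map_zero]; exact zero_le
      · obtain ⟨m, hm⟩ := heven _ hσnew hnew0
        by_cases hc0 : c = 0
        · exfalso; apply hcn0
          have h := hcn; rw [hc0, map_zero, mul_zero, le_zero_iff] at h
          exact (Valuation.zero_iff _).1 h
        obtain ⟨k, hk⟩ := heven c hσc hc0
        obtain ⟨l, hl⟩ := heven cn (hfix γ ν) hcn0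
        have h1 : Valued.v (cn + e * (σ γ' * γ')) < Valued.v cn := hlt
        rw [hm, hl, WithZero.exp_lt_exp] at h1
        have h2' : Valued.v cn ≤ Valued.v ϖ ^ (2 * n) * Valued.v c := hcn
        rw [hl, hk, hϖ, ← WithZero.exp_nsmul, ← WithZero.exp_add, WithZero.exp_le_exp] at h2'
        rw [hm, hk, hϖ, ← WithZero.exp_nsmul, ← WithZero.exp_add, WithZero.exp_le_exp]
        rw [nsmul_eq_mul] at h2' ⊢
        push_cast at h2' ⊢
        omega

/-- **THE NORM–TRACE DESCENT** (the arithmetic input of type-two transitivity at every ramified place — tame, R-P and R-U alike; replaces the `½` and the first-order norm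
property of the tame files).  `σ` an involution preserving `v`, `ϖ` a uniformiser, `σ` residually trivial, ramified (`heven`), `2 ≠ 0`, finite residue field.  For a `σ`-fixed unit
`e` and a `σ`-fixed `c` with `|c| ≤ |ϖ|²` there are `γ` with `|γ| ≤ |ϖ|` and `ν ∈ 𝒪` with `c + e·σγ·γ + (ν·σϖ + σν·ϖ) = 0`.  TAME (`|2| = 1`): `γ = 0`, `ν = −c∕(2σϖ)`.  WILD
(`|2| < 1`): `norm_trace_descent_of_ramified` down to `|c_n| ≤ |2ϖ|`, then `ν ↦ ν − c_n∕(2σϖ)`. [cite: Jacobowitz1962, §9] [cite: Omeara1963, §63A] [cite: Serre1979, Ch. V §3] -/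
theorem exists_norm_add_trace_eq_zero_of_ramified [Finite 𝓀[K]] (hσ : ∀ x, σ (σ x) = x) (hvσ : ∀ a, Valued.v (σ a) = Valued.v a)
    (hϖ : Valued.v ϖ = WithZero.exp (-1 : ℤ)) (hres : ∀ x : K, Valued.v x ≤ 1 → Valued.v (σ x - x) < 1)
    (heven : ∀ x : K, σ x = x → x ≠ 0 → ∃ n : ℤ, Valued.v x = WithZero.exp (2 * n)) (h20 : (2 : K) ≠ 0)
    {e c : K} (hσe : σ e = e) (hve : Valued.v e = 1) (hσc : σ c = c) (hvc : Valued.v c ≤ Valued.v ϖ ^ 2) :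
    ∃ γ ν : K, Valued.v γ ≤ Valued.v ϖ ∧ Valued.v ν ≤ 1 ∧ c + e * (σ γ * γ) + (ν * σ ϖ + σ ν * ϖ) = 0 := by
  have hϖ0 : ϖ ≠ 0 := uniformizer_ne_zero hϖ
  have hvϖ0 : Valued.v ϖ ≠ 0 := (Valuation.ne_zero_iff Valued.v).2 hϖ0
  have hσϖ0 : σ ϖ ≠ 0 := (map_ne_zero σ).2 hϖ0
  have hϖ1 : Valued.v ϖ < 1 := by rw [hϖ, ← WithZero.exp_zero, WithZero.exp_lt_exp]; omega
  have hσ2 : σ 2 = 2 := map_ofNat σ 2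
  have hv2 : Valued.v (2 : K) ≤ 1 := by rw [show (2 : K) = 1 + 1 by norm_num]; exact (Valuation.map_add _ _ _).trans (by rw [map_one, max_self])
  have hv20 : Valued.v (2 : K) ≠ 0 := (Valuation.ne_zero_iff _).2 h20
  -- the finishing move: a `σ`-fixed `c′` with `|c′| ≤ |2ϖ|` is `−(ν′σϖ + σν′ϖ)`, `ν′ = −c′/(2σϖ) ∈ 𝒪`
  have hfinish : ∀ {c' γ ν : K}, σ c' = c' → Valued.v c' ≤ Valued.v (2 * ϖ) → Valued.v γ ≤ Valued.v ϖ → Valued.v ν ≤ 1 →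
      c + e * (σ γ * γ) + (ν * σ ϖ + σ ν * ϖ) = c' →
      ∃ γ ν : K, Valued.v γ ≤ Valued.v ϖ ∧ Valued.v ν ≤ 1 ∧ c + e * (σ γ * γ) + (ν * σ ϖ + σ ν * ϖ) = 0 := by
    intro c' γ ν hσc' hvc' hγ hν heq
    have hvν' : Valued.v (c' / (2 * σ ϖ)) ≤ 1 := by
      rw [map_div₀, map_mul, hvσ, ← map_mul]
      exact div_le_one_of_le₀ hvc' zero_le
    refine ⟨γ, ν - c' / (2 * σ ϖ), hγ, (Valuation.map_sub _ _ _).trans (max_le hν hvν'), ?_⟩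
    have hσq : σ (c' / (2 * σ ϖ)) = c' / (2 * ϖ) := by rw [map_div₀, map_mul, hσc', hσ2, hσ]
    rw [map_sub, hσq]
    have h : c + e * (σ γ * γ) + ((ν - c' / (2 * σ ϖ)) * σ ϖ + (σ ν - c' / (2 * ϖ)) * ϖ) = (c + e * (σ γ * γ) + (ν * σ ϖ + σ ν * ϖ)) - c' := by
      field_simp
      ring
    rw [h, heq, sub_self]
  by_cases h2 : Valued.v (2 : K) = 1
  · -- tame: `|c| ≤ |ϖ|² ≤ |2ϖ|`
    refine hfinish hσc ?_ (by rw [map_zero]; exact zero_le) (by rw [map_zero]; exact zero_le) (by simp)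
    rw [map_mul, h2, one_mul]
    exact hvc.trans (by rw [pow_two]; exact mul_le_of_le_one_left' hϖ1.le)
  · -- wild
    have h2lt : Valued.v (2 : K) < 1 := lt_of_le_of_ne hv2 h2
    -- choose `n` with `|ϖ|^{2n}·|c| ≤ |2ϖ|`
    obtain ⟨k, hk⟩ : ∃ k : ℤ, Valued.v (2 : K) = WithZero.exp k := ⟨WithZero.log (Valued.v (2 : K)), (WithZero.exp_log hv20).symm⟩
    have hk0 : k ≤ 0 := by rw [hk, ← WithZero.exp_zero, WithZero.exp_le_exp] at hv2; exact hv2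
    obtain ⟨n, hn⟩ : ∃ n : ℕ, (n : ℤ) = -k := ⟨(-k).toNat, by omega⟩
    obtain ⟨γ, ν, hγ, hν, hle⟩ := norm_trace_descent_of_ramified hσ hvσ hϖ hres heven h2lt hσe hve hσc hvc n
    have hσc' : σ (c + e * (σ γ * γ) + (ν * σ ϖ + σ ν * ϖ)) = c + e * (σ γ * γ) + (ν * σ ϖ + σ ν * ϖ) := by
      simp only [map_add, map_mul, hσ, hσe, hσc]; ring
    refine hfinish hσc' (hle.trans ?_) hγ hν rfl
    calc Valued.v ϖ ^ (2 * n) * Valued.v c ≤ Valued.v ϖ ^ (2 * n) * Valued.v ϖ ^ 2 := mul_le_mul' le_rfl hvc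
      _ ≤ Valued.v (2 * ϖ) := by
          rw [← pow_add, map_mul, hk, hϖ, ← WithZero.exp_nsmul, ← WithZero.exp_add, WithZero.exp_le_exp, nsmul_eq_mul]
          push_cast; omega

end Literature.NumberTheory.Automorphic.UnitaryLatticeTree
end
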